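import Summits.QuantumFields.YangMills.Theorems.BalabanUVNodesN15KingModelTorusFreeDeterminant
import Summits.QuantumFields.YangMills.Theorems.BalabanUVNodesN15KingModelLatticeRiemannSums
import HarnessLib

/-!
# BalabanUVNodes ∕ N15 — THE KING-MODEL RUNG (PART Ε-m): THE THERMODYNAMIC LIMIT OF THE FREE ENERGY DENSITY OF KING's FINE FREE FIELD —
# `|Ω|⁻¹·log det(c(−Δ)+m²)_{Π_νℤ∕M_ν} → (2π)^{−(d+1)}∫_{(−π,π]^{d+1}} log(m² + cΣ_μ(2 − 2cos p_μ)) dp` as all `M_ν → ∞` (Szegő-type limit for the massive lattice Laplacian)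
# (Track A, DAG node N15 = NE2; FAN-OUT v1.1 §N15 s3 «KING-MODEL RUNG»; the volume limit of Ε-k's closed-form determinant; count-neutral)

HONEST FRAMING.  Count-neutral (cell `pub-ymgap`, seat `pub-ymgap-dag-n15-e` g40; `--supports stmt-QuantumFields-27366 --as helper` = K3⁸).
TEMPLATE LITERATURE: C. King, Commun. Math. Phys. **102** (1986) 649–677 [King1986], (2.6) p.652 and (3.89)–(3.93) pp.668–669 (the Gaussian normalisations, `ln N_k = −½ ln det`;
(3.93): extensivity of `ln N` with constants uniform in the volume), (4.4) p.670 (the symbol), (4.35) p.674 (plane-wave sums over the dual torus); [Balaban1984PropagatorsI] (1.29) p.23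
(the dual torus `p_μ = (π∕L′_μ)n_μ, −L′_μ ≤ n_μ < L′_μ`).  Part Ε-k gave `log det(lapF K c m²) = Σ_{q∈Ω̂} log lapSym(q)` on every torus.  THIS FILE takes the volume to infinity:
the dual-torus sum is a LATTICE RIEMANN SUM of the continuous periodic function `h(p) = log(m² + cΣ_μ(2−2cos p_μ))` over the momentum box `(−π,π]^{d+1}` with mesh `2π∕M_ν`
(the reduced momenta `p′(q) = 2π·valMinAbs(q)∕M` ARE the mesh points of the centred integer box `−M_ν < 2k_ν ≤ M_ν`), and the lineage's dominated-convergence engine for lattice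
sums (part Ϝ-i `…KingModelLatticeRiemannSums.tendsto_latticeSum_of_dominated`, g33) gives the limit:
§1 `kingLogSym c m² p`; `lapSym_eq_kingLogSym` (King's `lapSym` IS `h` at the mesh point of `vmaIdx q = (valMinAbs q_ν)_ν`); continuity and the two-sided bound
`log m² ≤ h ≤ log(m²+4c(d+1))`; §2 the box-supported summand `freeEnergyRiemannTerm` and ★ `sum_log_lapSym_eq_latticeSum` (`Σ_q log lapSym(q) = Σ'_{k∈ℤ^{d+1}} c(k)`,
`vmaIdx` injective with range = the centred box, `ZMod.valMinAbs_spec`); §3 ★ `eventually_inBox_iff` (in one coordinate the box indicator of `⌊t∕(2π∕M)⌋` is EVENTUALLY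
`1_{(−π,π]}(t)` as `M → ∞`); §4 ★★★ **`tendsto_sum_log_lapSym_div_card`** and ★★★ **`tendsto_log_det_lapF_div_card`**: along ANY sequence of tori `Π_νℤ∕M_{k,ν}` with every
`M_{k,ν} → ∞`, `|Ω_k|⁻¹·log det(lapF (M_k) c m²) → kingFreeEnergyInf c m² d := (2π)^{−(d+1)}∫ 1_{(−π,π]^{d+1}}·h`; ★★ **`kingFreeEnergyInf_bounds`** (`log m² ≤ · ≤ log(m²+4c(d+1))`,
Ε-k's per-volume bounds passed to the limit).

PRIOR TREE ART (used, not restated): part Ε-k (`log_det_lapF`, `freeEnergyDensity_bounds`), `King1986.EffectiveLaplacianSymbol` (`lapSym`, `lapSym_ge`), `B5Prop11Plancherel` (`sOf`),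
part Ε-e (`lapSym_le`), part Ϝ-i `…LatticeRiemannSums` (`floorIdx`, `cornerPt`, `tendsto_cornerPt`, `tendsto_latticeSum_of_dominated`).  NOT Bałaban's covariant objects; NOT a node
discharge (N15 is booked through n15-a's knit, untouched); nothing continuum-YM ∕ `ℝ⁴` ∕ OS ∕ Clay.  0 `sorry`; 4 `def` (`kingLogSym`, `vmaIdx`, `freeEnergyRiemannTerm`, `kingFreeEnergyInf`).

HONEST SCOPE.  `c ≥ 0`, `m² > 0`, any `d`; folklore real analysis (continuity + dominated convergence); no rate in the volume is claimed; the Gaussian-integral identification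
`ln 𝒩 = ½|Ω|log(2π) − ½ log det` remains a door (the lineage's normalisations are typed determinant-free).  Locators: [King1986] (2.6) p.652, (3.89)–(3.93) pp.668–669, (4.4) p.670,
(4.35) p.674; [Balaban1984PropagatorsI] (1.29) p.23.
-/

noncomputable section

open scoped BigOperators Topology
open Finset Filter MeasureTheory

namespace Summit.QuantumFields.YangMills.BalabanUVNodes.N15KingModelRung.TorusSpectral

open Literature.MathematicalPhysics.QuantumFieldTheory.Balaban1983to89.B5Prop11Plancherel (Tor sOf)
open Literature.MathematicalPhysics.QuantumFieldTheory.King1986.Torus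
open Summit.QuantumFields.YangMills.BalabanUVNodes.N15KingModelRung.LatticeRiemann (floorIdx cornerPt tendsto_cornerPt tendsto_latticeSum_of_dominated)

variable {d : ℕ}

/-! ## §1 The integrand `h(p) = log(m² + cΣ_μ(2 − 2cos p_μ))` -/

section Integrand

/-- THE FREE-ENERGY INTEGRAND `h(p) = log(m² + cΣ_μ(2 − 2cos p_μ))` (the logarithm of King's symbol (4.4)). [cite: King1986, (4.4) p.670, (3.89) p.668] -/
def kingLogSym (c m2 : ℝ) (p : Fin (d + 1) → ℝ) : ℝ := Real.log (m2 + c * ∑ μ, (2 - 2 * Real.cos (p μ)))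

/-- THE CENTRED INTEGER VECTOR of a dual-torus point: `(valMinAbs q_ν)_ν`, `−M_ν < 2·valMinAbs ≤ M_ν` (B5's `−L′_μ ≤ n_μ < L′_μ` up to the endpoint convention).
[cite: Balaban1984PropagatorsI, (1.29) p.23] -/
def vmaIdx (K : Fin (d + 1) → ℕ) (q : Tor K) : Fin (d + 1) → ℤ := fun ν => ((q ν).valMinAbs : ℤ)

variable {c m2 : ℝ}

/-- the symbol argument is at least `m²` (`c ≥ 0`). [folklore] -/
theorem le_symArg (hc : 0 ≤ c) (m2 : ℝ) (p : Fin (d + 1) → ℝ) : m2 ≤ m2 + c * ∑ μ, (2 - 2 * Real.cos (p μ)) :=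
  le_add_of_nonneg_right (mul_nonneg hc (Finset.sum_nonneg fun μ _ => by linarith [Real.cos_le_one (p μ)]))

/-- the symbol argument is at most `m² + 4c(d+1)`. [folklore] -/
theorem symArg_le (hc : 0 ≤ c) (m2 : ℝ) (p : Fin (d + 1) → ℝ) : m2 + c * ∑ μ, (2 - 2 * Real.cos (p μ)) ≤ m2 + 4 * c * (d + 1) := by
  have hs : ∑ μ : Fin (d + 1), (2 - 2 * Real.cos (p μ)) ≤ 4 * (d + 1) := by
    have := Finset.sum_le_sum fun μ (_ : μ ∈ (Finset.univ : Finset (Fin (d + 1)))) => (by linarith [Real.neg_one_le_cos (p μ)] : 2 - 2 * Real.cos (p μ) ≤ 4)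
    rw [Finset.sum_const, Finset.card_univ, Fintype.card_fin, nsmul_eq_mul] at this
    push_cast at this
    linarith
  nlinarith

/-- ★ two-sided bound of the integrand: `log m² ≤ h(p) ≤ log(m² + 4c(d+1))`. [cite: King1986, (4.4) p.670] -/
theorem kingLogSym_bounds (hc : 0 ≤ c) (hm : 0 < m2) (p : Fin (d + 1) → ℝ) :
    Real.log m2 ≤ kingLogSym c m2 p ∧ kingLogSym c m2 p ≤ Real.log (m2 + 4 * c * (d + 1)) :=
  ⟨Real.log_le_log hm (le_symArg hc m2 p), Real.log_le_log (lt_of_lt_of_le hm (le_symArg hc m2 p)) (symArg_le hc m2 p)⟩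

/-- `|h(p)| ≤ B := |log m²| + |log(m² + 4c(d+1))|`. [folklore] -/
theorem abs_kingLogSym_le (hc : 0 ≤ c) (hm : 0 < m2) (p : Fin (d + 1) → ℝ) :
    |kingLogSym c m2 p| ≤ |Real.log m2| + |Real.log (m2 + 4 * c * (d + 1))| := by
  obtain ⟨h1, h2⟩ := kingLogSym_bounds (d := d) hc hm p
  rw [abs_le]
  constructor <;> linarith [neg_abs_le (Real.log m2), le_abs_self (Real.log (m2 + 4 * c * (d + 1))), abs_nonneg (Real.log m2),
    abs_nonneg (Real.log (m2 + 4 * c * (d + 1)))]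

/-- `h` is continuous. [folklore] -/
theorem continuous_kingLogSym (hc : 0 ≤ c) (hm : 0 < m2) : Continuous (kingLogSym (d := d) c m2) := by
  unfold kingLogSym
  refine Continuous.log (f := fun p : Fin (d + 1) → ℝ => m2 + c * ∑ μ, (2 - 2 * Real.cos (p μ))) (by fun_prop)
    fun p => (lt_of_lt_of_le hm (le_symArg hc m2 p)).ne'

/-- ★ KING's SYMBOL AT A DUAL-TORUS POINT IS `h` AT THE MESH POINT: `log lapSym K c m² q = h(cornerPt (2π∕K) (vmaIdx q))`. [cite: King1986, (4.4) p.670; Balaban1984PropagatorsI, (1.29) p.23] -/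
theorem log_lapSym_eq_kingLogSym (K : Fin (d + 1) → ℕ) [∀ μ, NeZero (K μ)] (c m2 : ℝ) (q : Tor K) :
    Real.log (lapSym K c m2 q) = kingLogSym c m2 (cornerPt (fun ν => 2 * Real.pi / (K ν : ℝ)) (vmaIdx K q)) := by
  have h : ∀ ν, sOf K q ν = cornerPt (fun ν => 2 * Real.pi / (K ν : ℝ)) (vmaIdx K q) ν := fun ν => by
    have hK : (K ν : ℝ) ≠ 0 := by exact_mod_cast NeZero.ne (K ν)
    simp only [cornerPt, vmaIdx, sOf]
    field_simp
  unfold kingLogSym lapSym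
  simp_rw [h]

end Integrand

/-! ## §2 The dual-torus sum is a lattice Riemann sum over the centred box -/

section RiemannSum

variable (K : Fin (d + 1) → ℕ) [hK : ∀ μ, NeZero (K μ)] (c m2 : ℝ)

/-- THE BOX-SUPPORTED SUMMAND: `c(k) = h(2πk∕K)` if `−K_ν < 2k_ν ≤ K_ν` for all `ν` (the centred box = the range of `valMinAbs`), `0` otherwise. [cite: Balaban1984PropagatorsI, (1.29) p.23] -/
def freeEnergyRiemannTerm (k : Fin (d + 1) → ℤ) : ℝ :=
  if ∀ ν, -(K ν : ℤ) < k ν * 2 ∧ k ν * 2 ≤ K ν then kingLogSym c m2 (cornerPt (fun ν => 2 * Real.pi / (K ν : ℝ)) k) else 0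

omit hK in
/-- `vmaIdx` is injective. [folklore] -/
theorem vmaIdx_injective : Function.Injective (vmaIdx K) := by
  intro q q' h
  funext ν
  have := congrFun h ν
  simp only [vmaIdx] at this
  rw [← ZMod.coe_valMinAbs (q ν), ← ZMod.coe_valMinAbs (q' ν), this]

/-- the range of `vmaIdx` is the centred box. [folklore] -/
theorem mem_range_vmaIdx_iff (k : Fin (d + 1) → ℤ) : k ∈ Set.range (vmaIdx K) ↔ ∀ ν, -(K ν : ℤ) < k ν * 2 ∧ k ν * 2 ≤ K ν := by
  constructor
  · rintro ⟨q, rfl⟩ ν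
    exact (ZMod.valMinAbs_mem_Ioc (q ν))
  · intro h
    refine ⟨fun ν => ((k ν : ℤ) : ZMod (K ν)), funext fun ν => ?_⟩
    exact (ZMod.valMinAbs_spec _ _).2 ⟨rfl, h ν⟩

omit hK in
/-- off the range the summand vanishes. [folklore] -/
theorem freeEnergyRiemannTerm_eq_zero [∀ μ, NeZero (K μ)] {k : Fin (d + 1) → ℤ} (hk : k ∉ Set.range (vmaIdx K)) : freeEnergyRiemannTerm K c m2 k = 0 := by
  rw [mem_range_vmaIdx_iff] at hk
  exact if_neg hk

/-- on the range the summand is `log lapSym`. [folklore] -/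
theorem freeEnergyRiemannTerm_vmaIdx (q : Tor K) : freeEnergyRiemannTerm K c m2 (vmaIdx K q) = Real.log (lapSym K c m2 q) := by
  unfold freeEnergyRiemannTerm
  rw [if_pos ((mem_range_vmaIdx_iff K _).1 ⟨q, rfl⟩), log_lapSym_eq_kingLogSym]

/-- ★ **THE DUAL-TORUS SUM IS A LATTICE SUM**: `Σ_{q∈Ω̂} log lapSym(q) = Σ_{k∈ℤ^{d+1}} c(k)`. [cite: King1986, (4.35) p.674; Balaban1984PropagatorsI, (1.29) p.23] -/
theorem sum_log_lapSym_eq_latticeSum :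
    ∑ q : Tor K, Real.log (lapSym K c m2 q) = ∑' k : Fin (d + 1) → ℤ, freeEnergyRiemannTerm K c m2 k := by
  rw [← (vmaIdx_injective K).tsum_eq (fun k hk => ?_), tsum_fintype]
  · exact Finset.sum_congr rfl fun q _ => (freeEnergyRiemannTerm_vmaIdx K c m2 q).symm
  · exact Function.mem_support.mp hk |> fun h => by_contra fun hk' => h (freeEnergyRiemannTerm_eq_zero K c m2 hk')

/-- the volume factor: `|Ω|⁻¹ = (2π)^{−(d+1)}·Π_ν(2π∕K_ν)`. [folklore] -/
theorem inv_card_tor_eq :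
    (Fintype.card (Tor K) : ℝ)⁻¹ = ((2 * Real.pi) ^ (d + 1))⁻¹ * ∏ ν, 2 * Real.pi / (K ν : ℝ) := by
  have hπ : (2 * Real.pi) ^ (d + 1) ≠ 0 := pow_ne_zero _ (mul_ne_zero two_ne_zero Real.pi_ne_zero)
  rw [Fintype.card_pi]
  push_cast
  simp only [ZMod.card]
  rw [Finset.prod_div_distrib, Finset.prod_const, Finset.card_univ, Fintype.card_fin, div_eq_mul_inv, ← mul_assoc, inv_mul_cancel₀ hπ, one_mul]

end RiemannSum

/-! ## §3 In one coordinate the box indicator is eventually the indicator of `(−π, π]` -/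

section OneDim

/-- ★ for `t ∈ ℝ` and periods `M_k → ∞`: eventually, `⌊t∕(2π∕M_k)⌋` lies in the centred box `−M_k < 2⌊·⌋ ≤ M_k` iff `−π < t ≤ π`. [folklore] -/
theorem eventually_inBox_iff (t : ℝ) (Mseq : ℕ → ℕ) (hpos : ∀ k, 0 < Mseq k) (hlim : Tendsto (fun k => (Mseq k : ℝ)) atTop atTop) :
    ∀ᶠ k in atTop, ((-(Mseq k : ℤ) < ⌊t / (2 * Real.pi / (Mseq k : ℝ))⌋ * 2 ∧ ⌊t / (2 * Real.pi / (Mseq k : ℝ))⌋ * 2 ≤ Mseq k) ↔ (-Real.pi < t ∧ t ≤ Real.pi)) := by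
  have hπ := Real.pi_pos
  -- rewrite the argument of the floor as `t·M∕(2π)`
  have harg : ∀ k, t / (2 * Real.pi / (Mseq k : ℝ)) = t * Mseq k / (2 * Real.pi) := fun k => by
    have : (0 : ℝ) < Mseq k := by exact_mod_cast hpos k
    field_simp
  -- generic floor facts: `y − 1 < ⌊y⌋ ≤ y`
  have hfl : ∀ y : ℝ, (⌊y⌋ : ℝ) ≤ y ∧ y - 1 < (⌊y⌋ : ℝ) := fun y => ⟨Int.floor_le y, by linarith [Int.lt_floor_add_one y]⟩
  by_cases ht1 : t ≤ Real.pi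
  · by_cases ht2 : -Real.pi < t
    · -- in the box, eventually: the left inequality needs `M(t+π) > 2π`
      have hev : ∀ᶠ k in atTop, 2 * Real.pi < (Mseq k : ℝ) * (t + Real.pi) := by
        have := hlim.eventually_gt_atTop (2 * Real.pi / (t + Real.pi))
        filter_upwards [this] with k hk
        rwa [div_lt_iff₀ (by linarith)] at hk
      filter_upwards [hev] with k hk
      simp only [ht1, ht2, and_self, iff_true, harg]
      obtain ⟨h1, h2⟩ := hfl (t * Mseq k / (2 * Real.pi))
      have hM : (0 : ℝ) < Mseq k := by exact_mod_cast hpos k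
      constructor
      · have : -(Mseq k : ℝ) < (⌊t * Mseq k / (2 * Real.pi)⌋ : ℝ) * 2 := by
          have e : t * Mseq k / (2 * Real.pi) * 2 = -(Mseq k : ℝ) + (Mseq k : ℝ) * (t + Real.pi) / Real.pi := by field_simp; ring
          have : (Mseq k : ℝ) * (t + Real.pi) / Real.pi > 2 := by rw [gt_iff_lt, lt_div_iff₀ hπ]; linarith
          nlinarith
        exact_mod_cast this
      · have : (⌊t * Mseq k / (2 * Real.pi)⌋ : ℝ) * 2 ≤ Mseq k := by
          have : t * Mseq k / (2 * Real.pi) * 2 ≤ Mseq k := by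
            rw [div_mul_eq_mul_div, div_le_iff₀ (by positivity)]; nlinarith
          linarith
        exact_mod_cast this
    · -- `t ≤ −π`: never in the box (left inequality fails)
      push Not at ht2
      refine Filter.Eventually.of_forall fun k => ?_
      simp only [harg]
      have hM : (0 : ℝ) < Mseq k := by exact_mod_cast hpos k
      have hle : (⌊t * Mseq k / (2 * Real.pi)⌋ : ℝ) * 2 ≤ -(Mseq k : ℝ) := by
        have : t * Mseq k / (2 * Real.pi) * 2 ≤ -(Mseq k : ℝ) := by
          rw [div_mul_eq_mul_div, div_le_iff₀ (by positivity)]; nlinarith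
        linarith [(hfl (t * Mseq k / (2 * Real.pi))).1]
      have hle' : ⌊t * (Mseq k : ℝ) / (2 * Real.pi)⌋ * 2 ≤ -(Mseq k : ℤ) := by exact_mod_cast hle
      constructor
      · rintro ⟨h, _⟩; exact absurd h (not_lt.mpr hle')
      · rintro ⟨h, _⟩; linarith
  · -- `t > π`: eventually out of the box (right inequality fails once `M(t−π) > 2π`)
    push Not at ht1
    have hev : ∀ᶠ k in atTop, 2 * Real.pi < (Mseq k : ℝ) * (t - Real.pi) := by
      have := hlim.eventually_gt_atTop (2 * Real.pi / (t - Real.pi))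
      filter_upwards [this] with k hk
      rwa [div_lt_iff₀ (by linarith)] at hk
    filter_upwards [hev] with k hk
    simp only [harg]
    have hM : (0 : ℝ) < Mseq k := by exact_mod_cast hpos k
    have hgt : (Mseq k : ℝ) < (⌊t * Mseq k / (2 * Real.pi)⌋ : ℝ) * 2 := by
      have e : t * Mseq k / (2 * Real.pi) * 2 = (Mseq k : ℝ) + (Mseq k : ℝ) * (t - Real.pi) / Real.pi := by field_simp; ring
      have : (Mseq k : ℝ) * (t - Real.pi) / Real.pi > 2 := by rw [gt_iff_lt, lt_div_iff₀ hπ]; linarith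
      nlinarith [(hfl (t * Mseq k / (2 * Real.pi))).2]
    have hgt' : (Mseq k : ℤ) < ⌊t * (Mseq k : ℝ) / (2 * Real.pi)⌋ * 2 := by exact_mod_cast hgt
    constructor
    · rintro ⟨_, h⟩; exact absurd h (not_le.mpr hgt')
    · rintro ⟨_, h⟩; linarith

end OneDim

/-! ## §4 The thermodynamic limit of the free energy density -/

section Limit

/-- **THE INFINITE-VOLUME FREE ENERGY DENSITY** `(2π)^{−(d+1)}∫_{(−π,π]^{d+1}} log(m² + cΣ_μ(2−2cos p_μ)) dp` (written with the indicator of the half-open zone).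
[cite: King1986, (3.89)–(3.93) pp.668–669, (4.4) p.670] -/
def kingFreeEnergyInf (c m2 : ℝ) (d : ℕ) : ℝ :=
  ((2 * Real.pi) ^ (d + 1))⁻¹ * ∫ p : Fin (d + 1) → ℝ, (if ∀ ν, -Real.pi < p ν ∧ p ν ≤ Real.pi then kingLogSym c m2 p else 0)

variable {c m2 : ℝ}

/-- ★★★ **THE THERMODYNAMIC LIMIT OF THE PLANE-WAVE SUM**: along ANY sequence of tori `Π_νℤ∕M_{k,ν}` with every `M_{k,ν} → ∞` (`M_{k,ν} ≥ 1`), for `c ≥ 0`, `m² > 0`: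
`|Ω_k|⁻¹Σ_{q∈Ω̂_k} log lapSym(q) → (2π)^{−(d+1)}∫_{(−π,π]^{d+1}} log(m² + cΣ(2−2cos p_μ))dp`. [cite: King1986, (3.89)–(3.93) pp.668–669, (4.35) p.674; Balaban1984PropagatorsI, (1.29) p.23] -/
theorem tendsto_sum_log_lapSym_div_card (hc : 0 ≤ c) (hm : 0 < m2) (Mseq : ℕ → Fin (d + 1) → ℕ) (hpos : ∀ k ν, 0 < Mseq k ν)
    (hlim : ∀ ν, Tendsto (fun k => (Mseq k ν : ℝ)) atTop atTop) :
    Tendsto (fun k => haveI : ∀ ν, NeZero (Mseq k ν) := fun ν => ⟨(hpos k ν).ne'⟩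
      (Fintype.card (Tor (Mseq k)) : ℝ)⁻¹ * ∑ q : Tor (Mseq k), Real.log (lapSym (Mseq k) c m2 q)) atTop (𝓝 (kingFreeEnergyInf c m2 d)) := by
  have hπ := Real.pi_pos
  -- meshes and summands
  set ℓ : ℕ → Fin (d + 1) → ℝ := fun k ν => 2 * Real.pi / (Mseq k ν : ℝ) with hℓ
  have hℓpos : ∀ k ν, 0 < ℓ k ν := fun k ν => by
    have : (0 : ℝ) < Mseq k ν := by exact_mod_cast hpos k ν
    simp only [hℓ]; positivity
  have hℓ0 : ∀ ν, Tendsto (fun k => ℓ k ν) atTop (𝓝 0) := fun ν => by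
    simp only [hℓ]; exact (tendsto_const_nhds (x := 2 * Real.pi)).div_atTop (hlim ν)
  set cs : ℕ → (Fin (d + 1) → ℤ) → ℝ := fun k => haveI : ∀ ν, NeZero (Mseq k ν) := fun ν => ⟨(hpos k ν).ne'⟩
    freeEnergyRiemannTerm (Mseq k) c m2 with hcs
  set F : (Fin (d + 1) → ℝ) → ℝ := fun p => if ∀ ν, -Real.pi < p ν ∧ p ν ≤ Real.pi then kingLogSym c m2 p else 0 with hF
  set B : ℝ := |Real.log m2| + |Real.log (m2 + 4 * c * (d + 1))| with hB
  set G : (Fin (d + 1) → ℝ) → ℝ := (Set.Icc (fun _ => -Real.pi) (fun _ => 3 * Real.pi)).indicator fun _ => B with hG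
  -- the engine's hypotheses
  have hGint : Integrable G := by
    rw [hG]
    have hI : IntegrableOn (fun _ : Fin (d + 1) → ℝ => B) (Set.Icc (fun _ : Fin (d + 1) => -Real.pi) (fun _ => 3 * Real.pi)) :=
      continuousOn_const.integrableOn_compact isCompact_Icc
    exact hI.integrable_indicator measurableSet_Icc
  have hcs_apply : ∀ k x, cs k (floorIdx (ℓ k) x) = if ∀ ν, -(Mseq k ν : ℤ) < ⌊x ν / (2 * Real.pi / (Mseq k ν : ℝ))⌋ * 2 ∧ ⌊x ν / (2 * Real.pi / (Mseq k ν : ℝ))⌋ * 2 ≤ Mseq k ν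
      then kingLogSym c m2 (cornerPt (ℓ k) (floorIdx (ℓ k) x)) else 0 := fun k x => rfl
  have hdom : ∀ k x, |cs k (floorIdx (ℓ k) x)| ≤ G x := by
    intro k x
    rw [hcs_apply]
    split_ifs with hbox
    · -- in the box: `x ∈ [−π, 3π]^{d+1}` and `|h| ≤ B`
      have hx : x ∈ Set.Icc (fun _ : Fin (d + 1) => -Real.pi) (fun _ => 3 * Real.pi) := by
        refine ⟨fun ν => ?_, fun ν => ?_⟩
        · obtain ⟨h1, _⟩ := hbox ν
          have hM : (0 : ℝ) < Mseq k ν := by exact_mod_cast hpos k ν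
          have hfl : (⌊x ν / (2 * Real.pi / (Mseq k ν : ℝ))⌋ : ℝ) ≤ x ν / (2 * Real.pi / (Mseq k ν : ℝ)) := Int.floor_le _
          have h1' : -(Mseq k ν : ℝ) < (⌊x ν / (2 * Real.pi / (Mseq k ν : ℝ))⌋ : ℝ) * 2 := by exact_mod_cast h1
          have e : x ν / (2 * Real.pi / (Mseq k ν : ℝ)) = x ν * Mseq k ν / (2 * Real.pi) := by field_simp
          rw [e] at hfl h1'
          have : -(Mseq k ν : ℝ) < x ν * Mseq k ν / (2 * Real.pi) * 2 := by linarith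
          rw [div_mul_eq_mul_div, lt_div_iff₀ (by positivity)] at this
          show -Real.pi ≤ x ν
          nlinarith
        · obtain ⟨_, h2⟩ := hbox ν
          have hM : (0 : ℝ) < Mseq k ν := by exact_mod_cast hpos k ν
          have hM1 : (1 : ℝ) ≤ Mseq k ν := by exact_mod_cast hpos k ν
          have hfl : x ν / (2 * Real.pi / (Mseq k ν : ℝ)) < (⌊x ν / (2 * Real.pi / (Mseq k ν : ℝ))⌋ : ℝ) + 1 := Int.lt_floor_add_one _
          have h2' : (⌊x ν / (2 * Real.pi / (Mseq k ν : ℝ))⌋ : ℝ) * 2 ≤ Mseq k ν := by exact_mod_cast h2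
          have e : x ν / (2 * Real.pi / (Mseq k ν : ℝ)) = x ν * Mseq k ν / (2 * Real.pi) := by field_simp
          rw [e] at hfl h2'
          have : x ν * Mseq k ν / (2 * Real.pi) * 2 < (Mseq k ν : ℝ) + 2 := by linarith
          rw [div_mul_eq_mul_div, div_lt_iff₀ (by positivity)] at this
          show x ν ≤ 3 * Real.pi
          nlinarith
      rw [hG, Set.indicator_of_mem hx]
      exact abs_kingLogSym_le hc hm _
    · rw [abs_zero, hG]
      exact Set.indicator_nonneg (fun _ _ => by positivity) x
  have hlimpt : ∀ x, Tendsto (fun k => cs k (floorIdx (ℓ k) x)) atTop (𝓝 (F x)) := by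
    intro x
    have hbox : ∀ᶠ k in atTop, (∀ ν, -(Mseq k ν : ℤ) < ⌊x ν / (2 * Real.pi / (Mseq k ν : ℝ))⌋ * 2 ∧ ⌊x ν / (2 * Real.pi / (Mseq k ν : ℝ))⌋ * 2 ≤ Mseq k ν)
        ↔ (∀ ν, -Real.pi < x ν ∧ x ν ≤ Real.pi) := by
      have h := Filter.eventually_all.2 fun ν => eventually_inBox_iff (x ν) (fun k => Mseq k ν) (fun k => hpos k ν) (hlim ν)
      filter_upwards [h] with k hk
      exact forall_congr' hk
    have hcont : Tendsto (fun k => kingLogSym c m2 (cornerPt (ℓ k) (floorIdx (ℓ k) x))) atTop (𝓝 (kingLogSym c m2 x)) :=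
      ((continuous_kingLogSym hc hm).tendsto x).comp (tendsto_cornerPt ℓ hℓpos hℓ0 x)
    by_cases hx : ∀ ν, -Real.pi < x ν ∧ x ν ≤ Real.pi
    · have hFx : F x = kingLogSym c m2 x := by rw [hF]; exact if_pos hx
      rw [hFx]
      refine hcont.congr' ?_
      filter_upwards [hbox] with k hk
      rw [hcs_apply, if_pos (hk.2 hx)]
    · have hFx : F x = 0 := by rw [hF]; exact if_neg hx
      rw [hFx]
      refine tendsto_const_nhds.congr' ?_
      filter_upwards [hbox] with k hk
      rw [hcs_apply, if_neg (fun h => hx (hk.1 h))]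
  have heng := tendsto_latticeSum_of_dominated ℓ hℓpos cs F G hGint hdom hlimpt
  have hlim' := heng.const_mul (((2 * Real.pi) ^ (d + 1))⁻¹)
  refine hlim'.congr fun k => ?_
  haveI : ∀ ν, NeZero (Mseq k ν) := fun ν => ⟨(hpos k ν).ne'⟩
  rw [inv_card_tor_eq (Mseq k), sum_log_lapSym_eq_latticeSum (Mseq k) c m2, mul_assoc]
  congr 1
  rw [tsum_mul_left]

/-- ★★★ **THE THERMODYNAMIC LIMIT OF THE FREE ENERGY DENSITY**: along any sequence of tori with all periods `→ ∞`, `|Ω_k|⁻¹·log det(c(−Δ)+m²)_{Ω_k} → kingFreeEnergyInf c m² d`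
(part Ε-k's closed form + the Riemann-sum limit). [cite: King1986, (2.6) p.652, (3.89)–(3.93) pp.668–669, (4.4) p.670] -/
theorem tendsto_log_det_lapF_div_card (hc : 0 ≤ c) (hm : 0 < m2) (Mseq : ℕ → Fin (d + 1) → ℕ) (hpos : ∀ k ν, 0 < Mseq k ν)
    (hlim : ∀ ν, Tendsto (fun k => (Mseq k ν : ℝ)) atTop atTop) :
    Tendsto (fun k => haveI : ∀ ν, NeZero (Mseq k ν) := fun ν => ⟨(hpos k ν).ne'⟩
      (Fintype.card (Tor (Mseq k)) : ℝ)⁻¹ * Real.log (lapF (Mseq k) c m2).det) atTop (𝓝 (kingFreeEnergyInf c m2 d)) := by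
  refine (tendsto_sum_log_lapSym_div_card hc hm Mseq hpos hlim).congr fun k => ?_
  haveI : ∀ ν, NeZero (Mseq k ν) := fun ν => ⟨(hpos k ν).ne'⟩
  rw [log_det_lapF (Mseq k) hc hm]

/-- ★★ **THE LIMIT INHERITS THE VOLUME-UNIFORM BOUNDS**: `log m² ≤ kingFreeEnergyInf c m² d ≤ log(m² + 4c(d+1))` (part Ε-k's per-site bounds along the cubes `(ℤ∕(k+1))^{d+1}`).
[cite: King1986, (3.93) p.669] -/
theorem kingFreeEnergyInf_bounds (hc : 0 ≤ c) (hm : 0 < m2) :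
    Real.log m2 ≤ kingFreeEnergyInf c m2 d ∧ kingFreeEnergyInf c m2 d ≤ Real.log (m2 + 4 * c * (d + 1)) := by
  have hl := tendsto_log_det_lapF_div_card (d := d) hc hm (fun k _ => k + 1) (fun k _ => Nat.succ_pos k)
    (fun ν => by
      have : Tendsto (fun k : ℕ => ((k : ℝ) + 1)) atTop atTop := tendsto_atTop_add_const_right _ 1 tendsto_natCast_atTop_atTop
      refine this.congr fun k => ?_
      push_cast; ring)
  constructor
  · exact ge_of_tendsto' hl fun k => (freeEnergyDensity_bounds (fun _ : Fin (d + 1) => k + 1) hc hm).1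
  · exact le_of_tendsto' hl fun k => (freeEnergyDensity_bounds (fun _ : Fin (d + 1) => k + 1) hc hm).2

end Limit

end Summit.QuantumFields.YangMills.BalabanUVNodes.N15KingModelRung.TorusSpectral

end
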